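import Summits.QuantumFields.YangMills.Theorems.BalabanUVNodesSpineReadingOfRecord13CoPHKComponentSizePeierls
import Literature.MathematicalPhysics.QuantumFieldTheory.Balaban1983to89.Node00.TwoRunSiteBlockAnimals

/-!
# THE PEIERLS ASSEMBLY AT BLOCK GRAIN — the component-size reading with thresholds `n K j · L^{4·lv K j}` finest sites, its bad class covered by the
# `≤ |Site_{lv}| · (3^d − 1)^{2(n−1)}` connected `n`-sets of `lv`-BLOCKS, so that the N20 face follows from ONE block energy letter `δ K j ^ n` per member; and the
# NUMERICAL half DISCHARGED: thresholds `n K j ≥ ⌈log₂ |Site_{lv K j}|⌉ + K + j + 3` and `2·(3^d − 1)²·δ₀ ≤ 1` give `W K ≤ δ₀ · 2^{−(K+1)} < 1`, summable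

Cell `pub-ymgap`, YM-PLAN Track A (HUMAN RULING D-0062; width push D-0149); seat `pub-ymgap-dag-n20-d` (R134 (a) N20 NE7b s3 = the U5d ∕ `crOfRecord₁₃` lineage, its declarer)
gen 33; companion of `…CoPHKComponentSizePeierls` (p710912: `sum_le_sum_sum_of_finite_cover`, `exists_eq_mk_of_mem_classSetK₁₃`, `relWeightBound_card_of_energyLetters`),
`…CoPHKComponentSizeLevels` (p704298: `relWeightBound_bigComponent_of_levelLetters`) and `Node00/TwoRunSiteBlockAnimals` (gen 33: `siteTouch_iterBlockOf`,
`exists_mem_animalCoverFamily_image_iterBlockOf_of_hasBigComponent`).  `--kind proof --supports stmt-QuantumFields-27366 --as helper` (K3⁸); COUNT-NEUTRAL; THEOREMS ONLY (0 `def`).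
[LF-II] = [Balaban1989LargeFieldII]; [III] = [Balaban1988Convergent].
WHY (located defect of p710912, numbers not adjectives).  p710912 counts connected `m`-sets of FINEST sites (`animalCoverFamily (SiteTouch (j := 0)) m`, entropy
`|Site_0| · (3^d − 1)^{2(m−1)}`) against an energy letter `ε ^ m`.  A level-`j` large-field region of record is a union of `𝐃_j`-cubes of `L^j · M · R_j` finest sites per side
([III] p. 256; `Node00.DOfRecord`), so «`Z_j ⊇ S`» has ONE cube's weight fraction `δ` for every connected `S` inside one cube: an inhabitable letter has `ε ≥ δ^{1∕|cube|}`, and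
`(3^d − 1)² · ε ≤ 1∕2` — what the numerical side `hlt` of p710912 needs term by term — fails unless `δ < 2^{−13.6·|cube|}`, `|cube| ≥ (M R_0)^4`.  The union bound pays `(3^d−1)²`
per SITE, the energy once per CUBE.  REPAIR: count animals of `lv`-BLOCKS (`B5Eq118OneStroke.iterBlockOf lv : Site P 0 → Site P lv`, blocks of `L^{4·lv}` finest sites): the SAME
dial `bigDialOfCard₁₃` with thresholds `n K j · L^{4·lv K j}`, the SAME `SiteTouch` ∕ `animalCoverFamily` machinery ONE LATTICE UP (`Site (F.P (K₀+K)) (lv K j)`), the event of a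
member `(y, A)` being «`↑A ⊆ iterBlockOf lv '' Z_j(u)`» (every block of the animal MEETS `Z_j`; for the block-saturated regions of record this is «lies inside `Z_j`»,
`Node00.biUnion_iterBlock_subset_of_subset_image`).  Entropy per level: `|Site_{lv}| · (3^d − 1)^{2(n−1)}`; energy per member: `δ K j ^ (n K j)` — now commensurable.
WHAT IS HERE.  §1 ★ `bad_level_subset_blockCover` ∕ ★ `sum_bad_level_le_sum_blockCover` (cover and union bound at block grain, step-preserving dial, cast-free own-step events as in
p710912); §2 ★★ `levelLetter_of_blockEnergyLetters_left ∕ _right` and ★★★ `relWeightBound_card_of_blockEnergyLetters` (block energy letters in both runs + `Σ_j a K j < 1` + summable ⇒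
`RelWeightBound` at the coarse carriers, `a K j := |Site_{lv K j}| · (3^d − 1)^{2(n K j − 1)} · δ K j ^ (n K j)`); §3 THE NUMERICAL HALF DISCHARGED [folklore real arithmetic]:
`levelTerm_le_of_schedule` (each level term `≤ δ₀ · 2^{−(K+j+2)}` once `n K j ≥ Nat.clog 2 |Site_{lv K j}| + K + j + 3`, `0 ≤ δ K j ≤ δ₀`, `2·(3^4−1)²·δ₀ ≤ 1`), `levelSum_le_of_schedule`
(`Σ_{j ≤ jcut K} ≤ δ₀ · 2^{−(K+1)}`), ★★★ `relWeightBound_card_of_blockEnergyLetters_of_schedule` (block energy letters ALONE ⇒ `RelWeightBound`, no numerical hypothesis left) and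
`relWeightBound_card_of_blockEnergyLetters_geometric` (the same with the displayed weight `W K := δ₀ · 2^{−(K+1)}`).
HONEST FRAMING.  [folklore] finite-sum bookkeeping + torus block geometry BY NAME + elementary real arithmetic; the block energy letters `δ K j` are HYPOTHESES (inhabited for no
family today; NOT PRINTED as two-run statements; LCS-shaped; plausible only when the block side `L^{lv}` reaches the `𝐃_j`-cube side — `lv = j + a`, `L^a = M·R_j` — a numeric
side condition on Bałaban's constants not checked here); the thresholds grow like `4(m + K₀ + K − lv)·log₂ L + K + j` blocks — a DIAL VALUE whose fitness for node U5's matching is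
the plan's call, not claimed; NO weight is bounded here, NO estimate proved; nothing of Bałaban's asserted; NE7 ∕ NE7b ∕ NE7c NOT PRINTED for `d = 4` ∕ NOT proved; no
`Provisos₁₃CoPH` inhabitant claimed (K0⁷ OPEN); K3⁸ v7 untouched; N19 ∕ N20 ∕ N21 ∕ N27 NOT discharged; counts UNMOVED (typed 28∕28 · discharged 8∕27); one finite four-torus
programme at fixed `ε` — NOT ℝ⁴, NOT OS, NOT a mass gap, NOT the Clay problem.  No `def`, no `instance`, no `notation`, no `sorry`; no decl below carries a cite tag.
-/

noncomputable section

open scoped BigOperators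
open Finset

namespace YMDAG.UVSplit

open Literature.MathematicalPhysics.QuantumFieldTheory.Balaban1983to89
open Literature.MathematicalPhysics.QuantumFieldTheory.Balaban1983to89.T4Continuum
open Literature.MathematicalPhysics.QuantumFieldTheory.Balaban1983to89.Node00
open Literature.MathematicalPhysics.QuantumFieldTheory.Balaban1983to89.B5Eq118OneStroke (iterBlockOf iterBlock)
open T4WeightBudget (RelWeightBound)
open Summit.QuantumFields.YangMills.BalabanUVNodes.N21KeyedShellWeightShellZero (weightA₁₃_nonneg weightB₁₃_nonneg)
open Summit.QuantumFields.YangMills.BalabanUVNodes.N20KeyedRelWeightAtKeyReading (fst_eq_of_mem_classSetK₁₃)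

variable {F : T4Family} {N : ℕ} [NeZero N]

/-! ## §1 The cover at class level and the union bound, at block grain -/

section Cover

variable (θ : Stage13HParams F N) (hP : θ.Provisos₁₃CoPH F N) (K₀ : ℕ) (g₀ : ℕ → ℝ) (os : List (ULoop F))
  (kr : ℕ → (Σ K, SiteSeqKey F (K₀ + K)) → (Σ K, SiteSeqKey F (K₀ + K))) (n lv : ℕ → ℕ → ℕ)

/-- ★ **A CLASS WITH A COMPONENT OF `≥ n K j · L^{4·lv K j}` FINEST SITES AT LEVEL `j` LIES IN THE EVENT CLASS OF SOME BLOCK-GRAIN COVER MEMBER** (step-preserving dial,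
`1 ≤ n K j`, block level `lv K j ≤ m + K₀ + K`): the event reading of the member `p = (y₀, A)` ∈ `animalCoverFamily (SiteTouch (j := lv K j)) (n K j)` is
«`↑A ⊆ iterBlockOf (lv K j) '' (y.2 j)ᶜ` for the key `y` with `u = ⟨K, y⟩`» (every block of the animal meets the level-`j` large-field region). [bookkeeping] -/
theorem bad_level_subset_blockCover (hkr : ∀ (K : ℕ) (x : Σ K, SiteSeqKey F (K₀ + K)), x ∈ classSet₁₃ θ K₀ g₀ K → (kr K x).1 = K) (K : ℕ) (t : ℝ) {j : ℕ}
    (hlv : lv K j ≤ F.m + (K₀ + K)) (h1 : 1 ≤ n K j) {u : Σ K, SiteSeqKey F (K₀ + K)}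
    (hu : u ∈ badClassK₁₃ θ K₀ g₀ kr
      (fun _ u => HasBigComponent SiteTouch (bigDialOfCard₁₃ (N := N) K₀ (fun K j => n K j * (F.L ^ 4) ^ lv K j) F θ hP g₀ os u.1 j) (u.2.2 j)ᶜ) K t) :
    ∃ p ∈ animalCoverFamily (SiteTouch (P := F.P (K₀ + K)) (j := lv K j)) (n K j),
      u ∈ badClassK₁₃ θ K₀ g₀ kr (fun _ u => ∀ y : SiteSeqKey F (K₀ + K), u = ⟨K, y⟩ →
        (↑p.2 : Set (Site (F.P (K₀ + K)) (lv K j))) ⊆ iterBlockOf (lv K j) '' (y.2 j)ᶜ) K t := by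
  obtain ⟨huS, hbig⟩ := (mem_badClassK₁₃_iff θ K₀ g₀ kr _ K t u).1 hu
  obtain ⟨y, rfl⟩ := exists_eq_mk_of_mem_classSetK₁₃ θ K₀ g₀ kr hkr K huS
  obtain ⟨p, hp, hpZ⟩ := exists_mem_animalCoverFamily_image_iterBlockOf_of_hasBigComponent (P := F.P (K₀ + K)) (ℓ := lv K j)
    (m := fun j => n K j * (F.L ^ 4) ^ lv K j) (lvl := j) (n := n K j) hlv h1 le_rfl hbig
  refine ⟨p, hp, (mem_badClassK₁₃_iff θ K₀ g₀ kr _ K t _).2 ⟨huS, ?_⟩⟩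
  intro y' hy'
  have hyy' : y = y' := eq_of_heq (Sigma.mk.inj hy').2
  rw [← hyy']
  exact hpZ

/-- ★ **THE UNION BOUND OVER THE BLOCK-GRAIN COVER FAMILY** (step-preserving dial, non-negative summand on the coarse class set, `1 ≤ n K j`, `lv K j ≤ m + K₀ + K`).
[bookkeeping] -/
theorem sum_bad_level_le_sum_blockCover (hkr : ∀ (K : ℕ) (x : Σ K, SiteSeqKey F (K₀ + K)), x ∈ classSet₁₃ θ K₀ g₀ K → (kr K x).1 = K) (K : ℕ) (t : ℝ) {j : ℕ}
    (hlv : lv K j ≤ F.m + (K₀ + K)) (h1 : 1 ≤ n K j) (f : (Σ K, SiteSeqKey F (K₀ + K)) → ℝ) (hf : ∀ u ∈ classSetK₁₃ θ K₀ g₀ kr K, 0 ≤ f u) :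
    ∑ u ∈ badClassK₁₃ θ K₀ g₀ kr
        (fun _ u => HasBigComponent SiteTouch (bigDialOfCard₁₃ (N := N) K₀ (fun K j => n K j * (F.L ^ 4) ^ lv K j) F θ hP g₀ os u.1 j) (u.2.2 j)ᶜ) K t, f u ≤
      ∑ p ∈ animalCoverFamily (SiteTouch (P := F.P (K₀ + K)) (j := lv K j)) (n K j),
        ∑ u ∈ badClassK₁₃ θ K₀ g₀ kr (fun _ u => ∀ y : SiteSeqKey F (K₀ + K), u = ⟨K, y⟩ →
          (↑p.2 : Set (Site (F.P (K₀ + K)) (lv K j))) ⊆ iterBlockOf (lv K j) '' (y.2 j)ᶜ) K t, f u := by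
  classical
  exact sum_le_sum_sum_of_finite_cover (classSetK₁₃ θ K₀ g₀ kr K) _ _ _ f (badClassK₁₃_subset θ K₀ g₀ kr _ K t)
    (fun p _ => badClassK₁₃_subset θ K₀ g₀ kr _ K t) hf (fun u hu => bad_level_subset_blockCover θ hP K₀ g₀ os kr n lv hkr K t hlv h1 hu)

end Cover

/-! ## §2 The level letter from block energy letters; the face assembled -/

section Assembly

variable (θ : Stage13HParams F N) (hP : θ.Provisos₁₃CoPH F N) (K₀ : ℕ) (g₀ : ℕ → ℝ) (os : List (ULoop F))
  (kr : ℕ → (Σ K, SiteSeqKey F (K₀ + K)) → (Σ K, SiteSeqKey F (K₀ + K))) (jcut : ℕ → ℕ) (n lv : ℕ → ℕ → ℕ)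

/-- ★★ **RUN A's LEVEL LETTER FROM BLOCK ENERGY LETTERS**: if for every member `(y₀, A)` of the block-grain cover family the coarse classes whose level-`j` region meets every
block of `A` weigh at most `δ K j ^ (n K j)` of run A's total (`0 ≤ δ`), then the classes with a component of `≥ n K j · L^{4·lv K j}` finest sites at level `j` weigh at most
`|Site_{lv K j}| · (3^d − 1)^{2(n K j − 1)} · δ K j ^ (n K j)` of it. [bookkeeping] -/
theorem levelLetter_of_blockEnergyLetters_left (hkr : ∀ (K : ℕ) (x : Σ K, SiteSeqKey F (K₀ + K)), x ∈ classSet₁₃ θ K₀ g₀ K → (kr K x).1 = K)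
    {δ : ℕ → ℕ → ℝ} (hδ : ∀ K j, 0 ≤ δ K j) (K : ℕ) {t : ℝ} {j : ℕ} (hlv : lv K j ≤ F.m + (K₀ + K)) (h1 : 1 ≤ n K j)
    (hE : ∀ p ∈ animalCoverFamily (SiteTouch (P := F.P (K₀ + K)) (j := lv K j)) (n K j),
      ∑ u ∈ badClassK₁₃ θ K₀ g₀ kr (fun _ u => ∀ y : SiteSeqKey F (K₀ + K), u = ⟨K, y⟩ →
          (↑p.2 : Set (Site (F.P (K₀ + K)) (lv K j))) ⊆ iterBlockOf (lv K j) '' (y.2 j)ᶜ) K t,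
          weightAK₁₃ θ hP K₀ g₀ os kr K t u ≤ δ K j ^ n K j * ∑ u ∈ classSetK₁₃ θ K₀ g₀ kr K, weightAK₁₃ θ hP K₀ g₀ os kr K t u) :
    ∑ u ∈ badClassK₁₃ θ K₀ g₀ kr
        (fun _ u => HasBigComponent SiteTouch (bigDialOfCard₁₃ (N := N) K₀ (fun K j => n K j * (F.L ^ 4) ^ lv K j) F θ hP g₀ os u.1 j) (u.2.2 j)ᶜ) K t,
        weightAK₁₃ θ hP K₀ g₀ os kr K t u ≤
      (Fintype.card (Site (F.P (K₀ + K)) (lv K j)) * ((3 : ℝ) ^ (F.P (K₀ + K)).d - 1) ^ (2 * (n K j - 1)) * δ K j ^ n K j) *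
        ∑ u ∈ classSetK₁₃ θ K₀ g₀ kr K, weightAK₁₃ θ hP K₀ g₀ os kr K t u := by
  classical
  have htot : 0 ≤ ∑ u ∈ classSetK₁₃ θ K₀ g₀ kr K, weightAK₁₃ θ hP K₀ g₀ os kr K t u :=
    Finset.sum_nonneg fun u _ => weightAK₁₃_nonneg θ hP K₀ g₀ os kr (fun x _ => weightA₁₃_nonneg F θ hP K₀ g₀ os K t x) u
  have hcard : ((animalCoverFamily (SiteTouch (P := F.P (K₀ + K)) (j := lv K j)) (n K j)).card : ℝ) ≤
      Fintype.card (Site (F.P (K₀ + K)) (lv K j)) * ((3 : ℝ) ^ (F.P (K₀ + K)).d - 1) ^ (2 * (n K j - 1)) := by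
    have h := card_animalCoverFamily_siteTouch_le_pred (P := F.P (K₀ + K)) (j := lv K j) (n K j)
    have h3 : (1 : ℕ) ≤ 3 ^ (F.P (K₀ + K)).d := Nat.one_le_pow _ _ (by norm_num)
    calc ((animalCoverFamily (SiteTouch (P := F.P (K₀ + K)) (j := lv K j)) (n K j)).card : ℝ)
        ≤ ((Fintype.card (Site (F.P (K₀ + K)) (lv K j)) * (3 ^ (F.P (K₀ + K)).d - 1) ^ (2 * (n K j - 1)) : ℕ) : ℝ) := by exact_mod_cast h
      _ = Fintype.card (Site (F.P (K₀ + K)) (lv K j)) * ((3 : ℝ) ^ (F.P (K₀ + K)).d - 1) ^ (2 * (n K j - 1)) := by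
          push_cast [Nat.cast_sub h3]
          ring
  calc ∑ u ∈ badClassK₁₃ θ K₀ g₀ kr
          (fun _ u => HasBigComponent SiteTouch (bigDialOfCard₁₃ (N := N) K₀ (fun K j => n K j * (F.L ^ 4) ^ lv K j) F θ hP g₀ os u.1 j) (u.2.2 j)ᶜ) K t,
          weightAK₁₃ θ hP K₀ g₀ os kr K t u
      ≤ ∑ p ∈ animalCoverFamily (SiteTouch (P := F.P (K₀ + K)) (j := lv K j)) (n K j),
          ∑ u ∈ badClassK₁₃ θ K₀ g₀ kr (fun _ u => ∀ y : SiteSeqKey F (K₀ + K), u = ⟨K, y⟩ →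
              (↑p.2 : Set (Site (F.P (K₀ + K)) (lv K j))) ⊆ iterBlockOf (lv K j) '' (y.2 j)ᶜ) K t,
            weightAK₁₃ θ hP K₀ g₀ os kr K t u :=
        sum_bad_level_le_sum_blockCover θ hP K₀ g₀ os kr n lv hkr K t hlv h1 _
          (fun u _ => weightAK₁₃_nonneg θ hP K₀ g₀ os kr (fun x _ => weightA₁₃_nonneg F θ hP K₀ g₀ os K t x) u)
    _ ≤ ∑ _p ∈ animalCoverFamily (SiteTouch (P := F.P (K₀ + K)) (j := lv K j)) (n K j),
          δ K j ^ n K j * ∑ u ∈ classSetK₁₃ θ K₀ g₀ kr K, weightAK₁₃ θ hP K₀ g₀ os kr K t u := Finset.sum_le_sum hE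
    _ = (animalCoverFamily (SiteTouch (P := F.P (K₀ + K)) (j := lv K j)) (n K j)).card *
          (δ K j ^ n K j * ∑ u ∈ classSetK₁₃ θ K₀ g₀ kr K, weightAK₁₃ θ hP K₀ g₀ os kr K t u) := by rw [Finset.sum_const, nsmul_eq_mul]
    _ ≤ (Fintype.card (Site (F.P (K₀ + K)) (lv K j)) * ((3 : ℝ) ^ (F.P (K₀ + K)).d - 1) ^ (2 * (n K j - 1))) *
          (δ K j ^ n K j * ∑ u ∈ classSetK₁₃ θ K₀ g₀ kr K, weightAK₁₃ θ hP K₀ g₀ os kr K t u) :=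
        mul_le_mul_of_nonneg_right hcard (mul_nonneg (pow_nonneg (hδ K j) _) htot)
    _ = _ := by ring

/-- ★★ **RUN B's LEVEL LETTER FROM BLOCK ENERGY LETTERS**, likewise. [bookkeeping] -/
theorem levelLetter_of_blockEnergyLetters_right (hkr : ∀ (K : ℕ) (x : Σ K, SiteSeqKey F (K₀ + K)), x ∈ classSet₁₃ θ K₀ g₀ K → (kr K x).1 = K)
    {δ : ℕ → ℕ → ℝ} (hδ : ∀ K j, 0 ≤ δ K j) (K : ℕ) {t : ℝ} {j : ℕ} (hlv : lv K j ≤ F.m + (K₀ + K)) (h1 : 1 ≤ n K j)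
    (hE : ∀ p ∈ animalCoverFamily (SiteTouch (P := F.P (K₀ + K)) (j := lv K j)) (n K j),
      ∑ u ∈ badClassK₁₃ θ K₀ g₀ kr (fun _ u => ∀ y : SiteSeqKey F (K₀ + K), u = ⟨K, y⟩ →
          (↑p.2 : Set (Site (F.P (K₀ + K)) (lv K j))) ⊆ iterBlockOf (lv K j) '' (y.2 j)ᶜ) K t,
          weightBK₁₃ θ hP K₀ g₀ os kr K t u ≤ δ K j ^ n K j * ∑ u ∈ classSetK₁₃ θ K₀ g₀ kr K, weightBK₁₃ θ hP K₀ g₀ os kr K t u) :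
    ∑ u ∈ badClassK₁₃ θ K₀ g₀ kr
        (fun _ u => HasBigComponent SiteTouch (bigDialOfCard₁₃ (N := N) K₀ (fun K j => n K j * (F.L ^ 4) ^ lv K j) F θ hP g₀ os u.1 j) (u.2.2 j)ᶜ) K t,
        weightBK₁₃ θ hP K₀ g₀ os kr K t u ≤
      (Fintype.card (Site (F.P (K₀ + K)) (lv K j)) * ((3 : ℝ) ^ (F.P (K₀ + K)).d - 1) ^ (2 * (n K j - 1)) * δ K j ^ n K j) *
        ∑ u ∈ classSetK₁₃ θ K₀ g₀ kr K, weightBK₁₃ θ hP K₀ g₀ os kr K t u := by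
  classical
  have htot : 0 ≤ ∑ u ∈ classSetK₁₃ θ K₀ g₀ kr K, weightBK₁₃ θ hP K₀ g₀ os kr K t u :=
    Finset.sum_nonneg fun u _ => weightBK₁₃_nonneg θ hP K₀ g₀ os kr (fun x _ => weightB₁₃_nonneg F θ hP K₀ g₀ os K t x) u
  have hcard : ((animalCoverFamily (SiteTouch (P := F.P (K₀ + K)) (j := lv K j)) (n K j)).card : ℝ) ≤
      Fintype.card (Site (F.P (K₀ + K)) (lv K j)) * ((3 : ℝ) ^ (F.P (K₀ + K)).d - 1) ^ (2 * (n K j - 1)) := by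
    have h := card_animalCoverFamily_siteTouch_le_pred (P := F.P (K₀ + K)) (j := lv K j) (n K j)
    have h3 : (1 : ℕ) ≤ 3 ^ (F.P (K₀ + K)).d := Nat.one_le_pow _ _ (by norm_num)
    calc ((animalCoverFamily (SiteTouch (P := F.P (K₀ + K)) (j := lv K j)) (n K j)).card : ℝ)
        ≤ ((Fintype.card (Site (F.P (K₀ + K)) (lv K j)) * (3 ^ (F.P (K₀ + K)).d - 1) ^ (2 * (n K j - 1)) : ℕ) : ℝ) := by exact_mod_cast h
      _ = Fintype.card (Site (F.P (K₀ + K)) (lv K j)) * ((3 : ℝ) ^ (F.P (K₀ + K)).d - 1) ^ (2 * (n K j - 1)) := by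
          push_cast [Nat.cast_sub h3]
          ring
  calc ∑ u ∈ badClassK₁₃ θ K₀ g₀ kr
          (fun _ u => HasBigComponent SiteTouch (bigDialOfCard₁₃ (N := N) K₀ (fun K j => n K j * (F.L ^ 4) ^ lv K j) F θ hP g₀ os u.1 j) (u.2.2 j)ᶜ) K t,
          weightBK₁₃ θ hP K₀ g₀ os kr K t u
      ≤ ∑ p ∈ animalCoverFamily (SiteTouch (P := F.P (K₀ + K)) (j := lv K j)) (n K j),
          ∑ u ∈ badClassK₁₃ θ K₀ g₀ kr (fun _ u => ∀ y : SiteSeqKey F (K₀ + K), u = ⟨K, y⟩ →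
              (↑p.2 : Set (Site (F.P (K₀ + K)) (lv K j))) ⊆ iterBlockOf (lv K j) '' (y.2 j)ᶜ) K t,
            weightBK₁₃ θ hP K₀ g₀ os kr K t u :=
        sum_bad_level_le_sum_blockCover θ hP K₀ g₀ os kr n lv hkr K t hlv h1 _
          (fun u _ => weightBK₁₃_nonneg θ hP K₀ g₀ os kr (fun x _ => weightB₁₃_nonneg F θ hP K₀ g₀ os K t x) u)
    _ ≤ ∑ _p ∈ animalCoverFamily (SiteTouch (P := F.P (K₀ + K)) (j := lv K j)) (n K j),
          δ K j ^ n K j * ∑ u ∈ classSetK₁₃ θ K₀ g₀ kr K, weightBK₁₃ θ hP K₀ g₀ os kr K t u := Finset.sum_le_sum hE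
    _ = (animalCoverFamily (SiteTouch (P := F.P (K₀ + K)) (j := lv K j)) (n K j)).card *
          (δ K j ^ n K j * ∑ u ∈ classSetK₁₃ θ K₀ g₀ kr K, weightBK₁₃ θ hP K₀ g₀ os kr K t u) := by rw [Finset.sum_const, nsmul_eq_mul]
    _ ≤ (Fintype.card (Site (F.P (K₀ + K)) (lv K j)) * ((3 : ℝ) ^ (F.P (K₀ + K)).d - 1) ^ (2 * (n K j - 1))) *
          (δ K j ^ n K j * ∑ u ∈ classSetK₁₃ θ K₀ g₀ kr K, weightBK₁₃ θ hP K₀ g₀ os kr K t u) :=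
        mul_le_mul_of_nonneg_right hcard (mul_nonneg (pow_nonneg (hδ K j) _) htot)
    _ = _ := by ring

/-- ★★★ **THE N20 FACE AT THE BLOCK-GRAIN CARDINALITY DIAL FROM BLOCK ENERGY LETTERS ALONE** (step-preserving dial; `n K j ≥ 1`; block levels `lv K j ≤ m + K₀ + K`):
block energy letters `δ K j ≥ 0` per cover member in both runs, with the entropy-weighted level sums `Σ_{j ≤ jcut K} |Site_{lv K j}| · (3^d − 1)^{2(n K j − 1)} · δ K j ^ (n K j)`
below `1` and summable in `K`, give `RelWeightBound` at the coarse carriers with the bad class of `badKeyReadingOfBigComponent₁₃ N K₀ jcut (bigDialOfCard₁₃ K₀ (n · L^{4·lv}))`.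
[bookkeeping] -/
theorem relWeightBound_card_of_blockEnergyLetters (hkr : ∀ (K : ℕ) (x : Σ K, SiteSeqKey F (K₀ + K)), x ∈ classSet₁₃ θ K₀ g₀ K → (kr K x).1 = K)
    {δ : ℕ → ℕ → ℝ} (hδ : ∀ K j, 0 ≤ δ K j) (hn : ∀ K j, 1 ≤ n K j) (hlv : ∀ K j, lv K j ≤ F.m + (K₀ + K))
    (hEA : ∀ (K : ℕ) (t : ℝ), |t| ≤ 1 → ∀ j ∈ Finset.Icc 1 (jcut K), ∀ p ∈ animalCoverFamily (SiteTouch (P := F.P (K₀ + K)) (j := lv K j)) (n K j),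
      ∑ u ∈ badClassK₁₃ θ K₀ g₀ kr (fun _ u => ∀ y : SiteSeqKey F (K₀ + K), u = ⟨K, y⟩ →
          (↑p.2 : Set (Site (F.P (K₀ + K)) (lv K j))) ⊆ iterBlockOf (lv K j) '' (y.2 j)ᶜ) K t,
          weightAK₁₃ θ hP K₀ g₀ os kr K t u ≤ δ K j ^ n K j * ∑ u ∈ classSetK₁₃ θ K₀ g₀ kr K, weightAK₁₃ θ hP K₀ g₀ os kr K t u)
    (hEB : ∀ (K : ℕ) (t : ℝ), |t| ≤ 1 → ∀ j ∈ Finset.Icc 1 (jcut K), ∀ p ∈ animalCoverFamily (SiteTouch (P := F.P (K₀ + K)) (j := lv K j)) (n K j),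
      ∑ u ∈ badClassK₁₃ θ K₀ g₀ kr (fun _ u => ∀ y : SiteSeqKey F (K₀ + K), u = ⟨K, y⟩ →
          (↑p.2 : Set (Site (F.P (K₀ + K)) (lv K j))) ⊆ iterBlockOf (lv K j) '' (y.2 j)ᶜ) K t,
          weightBK₁₃ θ hP K₀ g₀ os kr K t u ≤ δ K j ^ n K j * ∑ u ∈ classSetK₁₃ θ K₀ g₀ kr K, weightBK₁₃ θ hP K₀ g₀ os kr K t u)
    (hlt : ∀ K, ∑ j ∈ Finset.Icc 1 (jcut K),
      Fintype.card (Site (F.P (K₀ + K)) (lv K j)) * ((3 : ℝ) ^ (F.P (K₀ + K)).d - 1) ^ (2 * (n K j - 1)) * δ K j ^ n K j < 1)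
    (hsum : Summable fun K => ∑ j ∈ Finset.Icc 1 (jcut K),
      Fintype.card (Site (F.P (K₀ + K)) (lv K j)) * ((3 : ℝ) ^ (F.P (K₀ + K)).d - 1) ^ (2 * (n K j - 1)) * δ K j ^ n K j) :
    RelWeightBound 1 (classSetK₁₃ θ K₀ g₀ kr) (weightAK₁₃ θ hP K₀ g₀ os kr) (weightBK₁₃ θ hP K₀ g₀ os kr)
      (badClassK₁₃ θ K₀ g₀ kr (badKeyReadingOfBigComponent₁₃ N K₀ jcut (bigDialOfCard₁₃ K₀ (fun K j => n K j * (F.L ^ 4) ^ lv K j)) F θ hP g₀ os))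
      (fun K => ∑ j ∈ Finset.Icc 1 (jcut K),
        Fintype.card (Site (F.P (K₀ + K)) (lv K j)) * ((3 : ℝ) ^ (F.P (K₀ + K)).d - 1) ^ (2 * (n K j - 1)) * δ K j ^ n K j) := by
  have ha0 : ∀ K j, 0 ≤ Fintype.card (Site (F.P (K₀ + K)) (lv K j)) * ((3 : ℝ) ^ (F.P (K₀ + K)).d - 1) ^ (2 * (n K j - 1)) * δ K j ^ n K j := by
    intro K j
    have h3 : (1 : ℝ) ≤ (3 : ℝ) ^ (F.P (K₀ + K)).d := one_le_pow₀ (by norm_num)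
    exact mul_nonneg (mul_nonneg (Nat.cast_nonneg _) (pow_nonneg (by linarith) _)) (pow_nonneg (hδ K j) _)
  have hW := relWeightBound_bigComponent_of_levelLetters θ hP K₀ g₀ os kr jcut (bigDialOfCard₁₃ K₀ (fun K j => n K j * (F.L ^ 4) ^ lv K j)) hkr
    (a := fun K j => Fintype.card (Site (F.P (K₀ + K)) (lv K j)) * ((3 : ℝ) ^ (F.P (K₀ + K)).d - 1) ^ (2 * (n K j - 1)) * δ K j ^ n K j)
    (b := fun K j => Fintype.card (Site (F.P (K₀ + K)) (lv K j)) * ((3 : ℝ) ^ (F.P (K₀ + K)).d - 1) ^ (2 * (n K j - 1)) * δ K j ^ n K j)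
    ha0 (fun K t ht j hj => levelLetter_of_blockEnergyLetters_left θ hP K₀ g₀ os kr n lv hkr hδ K (hlv K j) (hn K j) (hEA K t ht j hj))
    (fun K t ht j hj => levelLetter_of_blockEnergyLetters_right θ hP K₀ g₀ os kr n lv hkr hδ K (hlv K j) (hn K j) (hEB K t ht j hj))
    (fun K => by simpa only [max_self] using hlt K) (by simpa only [max_self] using hsum)
  simpa only [max_self] using hW

end Assembly

/-! ## §3 The numerical half discharged: a threshold schedule under uniformly small block energy letters -/

section Schedule

/-- [folklore] **ONE LEVEL TERM UNDER THE SCHEDULE**: with `V = |Site_{lv}|` (any natural number), thresholds `n ≥ ⌈log₂ V⌉ + K + j + 3`, a letter `0 ≤ δ ≤ δ₀` and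
`2·(3^4 − 1)²·δ₀ ≤ 1`, the entropy-weighted term is at most `δ₀ · 2^{−(K+j+2)}`: `V · 80^{2(n−1)} · δ^n = V · (80² δ)^{n−1} · δ ≤ V · 2^{−(n−1)} · δ₀ ≤ δ₀ · 2^{−(K+j+2)}`
since `2^{n−1} ≥ 2^{⌈log₂ V⌉} · 2^{K+j+2} ≥ V · 2^{K+j+2}`. [bookkeeping] -/
theorem levelTerm_le_of_schedule {V nKj K j : ℕ} {δ δ₀ : ℝ} (hn : Nat.clog 2 V + K + j + 3 ≤ nKj) (hδ0 : 0 ≤ δ) (hδ1 : δ ≤ δ₀)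
    (hD : 2 * ((3 : ℝ) ^ 4 - 1) ^ 2 * δ₀ ≤ 1) :
    (V : ℝ) * ((3 : ℝ) ^ 4 - 1) ^ (2 * (nKj - 1)) * δ ^ nKj ≤ δ₀ * (1 / 2) ^ (K + j + 2) := by
  have hδ₀ : 0 ≤ δ₀ := hδ0.trans hδ1
  have h80 : (0 : ℝ) ≤ (3 : ℝ) ^ 4 - 1 := by norm_num
  have hn1 : 1 ≤ nKj := by omega
  -- the term rewritten as `V · (80² δ)^{n−1} · δ`
  have hterm : (V : ℝ) * ((3 : ℝ) ^ 4 - 1) ^ (2 * (nKj - 1)) * δ ^ nKj = (V : ℝ) * ((((3 : ℝ) ^ 4 - 1) ^ 2 * δ) ^ (nKj - 1) * δ) := by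
    have hpow : δ ^ nKj = δ ^ (nKj - 1) * δ := by
      rw [← pow_succ, Nat.sub_add_cancel hn1]
    rw [hpow, mul_pow, ← pow_mul, mul_comm 2 (nKj - 1)]
    ring
  -- `80² δ ≤ 1/2`
  have hhalf : ((3 : ℝ) ^ 4 - 1) ^ 2 * δ ≤ 1 / 2 := by
    have : ((3 : ℝ) ^ 4 - 1) ^ 2 * δ ≤ ((3 : ℝ) ^ 4 - 1) ^ 2 * δ₀ := mul_le_mul_of_nonneg_left hδ1 (pow_nonneg h80 2)
    linarith
  have hge : (0 : ℝ) ≤ ((3 : ℝ) ^ 4 - 1) ^ 2 * δ := mul_nonneg (pow_nonneg h80 2) hδ0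
  have hpowle : (((3 : ℝ) ^ 4 - 1) ^ 2 * δ) ^ (nKj - 1) ≤ (1 / 2 : ℝ) ^ (nKj - 1) := pow_le_pow_left₀ hge hhalf _
  -- `V ≤ 2^{⌈log₂ V⌉}` and the exponent bookkeeping `2^{n−1} ≥ V · 2^{K+j+2}`
  have hVle : (V : ℝ) ≤ (2 : ℝ) ^ Nat.clog 2 V := by exact_mod_cast Nat.le_pow_clog (by norm_num : 1 < 2) V
  have hexp : Nat.clog 2 V + (K + j + 2) ≤ nKj - 1 := by omega
  have hVhalf : (V : ℝ) * (1 / 2 : ℝ) ^ (nKj - 1) ≤ (1 / 2 : ℝ) ^ (K + j + 2) := by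
    have h2 : (1 / 2 : ℝ) ^ (nKj - 1) ≤ (1 / 2 : ℝ) ^ (Nat.clog 2 V + (K + j + 2)) :=
      pow_le_pow_of_le_one (by norm_num) (by norm_num) hexp
    calc (V : ℝ) * (1 / 2 : ℝ) ^ (nKj - 1) ≤ (2 : ℝ) ^ Nat.clog 2 V * (1 / 2 : ℝ) ^ (Nat.clog 2 V + (K + j + 2)) :=
          mul_le_mul hVle h2 (pow_nonneg (by norm_num) _) (pow_nonneg (by norm_num) _)
      _ = (1 / 2 : ℝ) ^ (K + j + 2) := by
          rw [pow_add, ← mul_assoc, ← mul_pow]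
          norm_num
  calc (V : ℝ) * ((3 : ℝ) ^ 4 - 1) ^ (2 * (nKj - 1)) * δ ^ nKj = (V : ℝ) * ((((3 : ℝ) ^ 4 - 1) ^ 2 * δ) ^ (nKj - 1) * δ) := hterm
    _ ≤ (V : ℝ) * ((1 / 2 : ℝ) ^ (nKj - 1) * δ₀) :=
        mul_le_mul_of_nonneg_left (mul_le_mul hpowle hδ1 hδ0 (pow_nonneg (by norm_num) _)) (Nat.cast_nonneg V)
    _ = (V : ℝ) * (1 / 2 : ℝ) ^ (nKj - 1) * δ₀ := by ring
    _ ≤ (1 / 2 : ℝ) ^ (K + j + 2) * δ₀ := mul_le_mul_of_nonneg_right hVhalf hδ₀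
    _ = δ₀ * (1 / 2) ^ (K + j + 2) := mul_comm _ _

/-- [folklore] **THE LEVEL SUM UNDER THE SCHEDULE** is at most `δ₀ · 2^{−(K+1)}` (`Σ_{1 ≤ j ≤ J} 2^{−j} ≤ Σ_{j < J+1} 2^{−j} ≤ 2`). [bookkeeping] -/
theorem levelSum_le_of_schedule (K₀ : ℕ) (jcut : ℕ → ℕ) (n lv : ℕ → ℕ → ℕ) {δ : ℕ → ℕ → ℝ} {δ₀ : ℝ} (hδ0 : ∀ K j, 0 ≤ δ K j) (hδ1 : ∀ K j, δ K j ≤ δ₀)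
    (hD : 2 * ((3 : ℝ) ^ 4 - 1) ^ 2 * δ₀ ≤ 1) (hn : ∀ K j, Nat.clog 2 (Fintype.card (Site (F.P (K₀ + K)) (lv K j))) + K + j + 3 ≤ n K j) (K : ℕ) :
    ∑ j ∈ Finset.Icc 1 (jcut K), Fintype.card (Site (F.P (K₀ + K)) (lv K j)) * ((3 : ℝ) ^ (F.P (K₀ + K)).d - 1) ^ (2 * (n K j - 1)) * δ K j ^ n K j ≤
      δ₀ * (1 / 2) ^ (K + 1) := by
  have hδ₀ : 0 ≤ δ₀ := (hδ0 0 0).trans (hδ1 0 0)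
  have hterm : ∀ j ∈ Finset.Icc 1 (jcut K),
      Fintype.card (Site (F.P (K₀ + K)) (lv K j)) * ((3 : ℝ) ^ (F.P (K₀ + K)).d - 1) ^ (2 * (n K j - 1)) * δ K j ^ n K j ≤ δ₀ * (1 / 2) ^ (K + j + 2) := by
    intro j _
    rw [T4Family.P_d]
    exact levelTerm_le_of_schedule (hn K j) (hδ0 K j) (hδ1 K j) hD
  have hgeom : ∑ j ∈ Finset.Icc 1 (jcut K), (1 / 2 : ℝ) ^ j ≤ 2 :=
    (Finset.sum_le_sum_of_subset_of_nonneg (by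
        intro j hj
        rw [Finset.mem_Icc] at hj
        exact Finset.mem_range.2 (by omega)) (fun j _ _ => pow_nonneg (by norm_num) j)).trans (sum_geometric_two_le (jcut K + 1))
  calc ∑ j ∈ Finset.Icc 1 (jcut K), Fintype.card (Site (F.P (K₀ + K)) (lv K j)) * ((3 : ℝ) ^ (F.P (K₀ + K)).d - 1) ^ (2 * (n K j - 1)) * δ K j ^ n K j
      ≤ ∑ j ∈ Finset.Icc 1 (jcut K), δ₀ * (1 / 2) ^ (K + j + 2) := Finset.sum_le_sum hterm
    _ = δ₀ * (1 / 2) ^ (K + 2) * ∑ j ∈ Finset.Icc 1 (jcut K), (1 / 2 : ℝ) ^ j := by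
        rw [Finset.mul_sum]
        refine Finset.sum_congr rfl fun j _ => ?_
        rw [show K + j + 2 = K + 2 + j by omega, pow_add]
        ring
    _ ≤ δ₀ * (1 / 2) ^ (K + 2) * 2 := mul_le_mul_of_nonneg_left hgeom (mul_nonneg hδ₀ (pow_nonneg (by norm_num) _))
    _ = δ₀ * (1 / 2) ^ (K + 1) := by rw [pow_succ]; ring

variable (θ : Stage13HParams F N) (hP : θ.Provisos₁₃CoPH F N) (K₀ : ℕ) (g₀ : ℕ → ℝ) (os : List (ULoop F))
  (kr : ℕ → (Σ K, SiteSeqKey F (K₀ + K)) → (Σ K, SiteSeqKey F (K₀ + K))) (jcut : ℕ → ℕ) (n lv : ℕ → ℕ → ℕ)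

/-- ★★★ **THE N20 FACE AT THE BLOCK-GRAIN DIAL FROM BLOCK ENERGY LETTERS ALONE — NO NUMERICAL HYPOTHESIS LEFT**: uniformly small block energy letters (`0 ≤ δ K j ≤ δ₀`,
`2·(3^4 − 1)²·δ₀ ≤ 1`, i.e. `δ₀ ≤ 1∕12800`) in both runs, under the threshold schedule `n K j ≥ ⌈log₂ |Site_{lv K j}|⌉ + K + j + 3` (block levels `lv K j ≤ m + K₀ + K`), give
`RelWeightBound` at the coarse carriers with the level-sum weight (which is `≤ δ₀ · 2^{−(K+1)}`: `< 1` and summable — `levelSum_le_of_schedule`). [bookkeeping] -/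
theorem relWeightBound_card_of_blockEnergyLetters_of_schedule
    (hkr : ∀ (K : ℕ) (x : Σ K, SiteSeqKey F (K₀ + K)), x ∈ classSet₁₃ θ K₀ g₀ K → (kr K x).1 = K)
    {δ : ℕ → ℕ → ℝ} {δ₀ : ℝ} (hδ0 : ∀ K j, 0 ≤ δ K j) (hδ1 : ∀ K j, δ K j ≤ δ₀) (hD : 2 * ((3 : ℝ) ^ 4 - 1) ^ 2 * δ₀ ≤ 1)
    (hn : ∀ K j, Nat.clog 2 (Fintype.card (Site (F.P (K₀ + K)) (lv K j))) + K + j + 3 ≤ n K j) (hlv : ∀ K j, lv K j ≤ F.m + (K₀ + K))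
    (hEA : ∀ (K : ℕ) (t : ℝ), |t| ≤ 1 → ∀ j ∈ Finset.Icc 1 (jcut K), ∀ p ∈ animalCoverFamily (SiteTouch (P := F.P (K₀ + K)) (j := lv K j)) (n K j),
      ∑ u ∈ badClassK₁₃ θ K₀ g₀ kr (fun _ u => ∀ y : SiteSeqKey F (K₀ + K), u = ⟨K, y⟩ →
          (↑p.2 : Set (Site (F.P (K₀ + K)) (lv K j))) ⊆ iterBlockOf (lv K j) '' (y.2 j)ᶜ) K t,
          weightAK₁₃ θ hP K₀ g₀ os kr K t u ≤ δ K j ^ n K j * ∑ u ∈ classSetK₁₃ θ K₀ g₀ kr K, weightAK₁₃ θ hP K₀ g₀ os kr K t u)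
    (hEB : ∀ (K : ℕ) (t : ℝ), |t| ≤ 1 → ∀ j ∈ Finset.Icc 1 (jcut K), ∀ p ∈ animalCoverFamily (SiteTouch (P := F.P (K₀ + K)) (j := lv K j)) (n K j),
      ∑ u ∈ badClassK₁₃ θ K₀ g₀ kr (fun _ u => ∀ y : SiteSeqKey F (K₀ + K), u = ⟨K, y⟩ →
          (↑p.2 : Set (Site (F.P (K₀ + K)) (lv K j))) ⊆ iterBlockOf (lv K j) '' (y.2 j)ᶜ) K t,
          weightBK₁₃ θ hP K₀ g₀ os kr K t u ≤ δ K j ^ n K j * ∑ u ∈ classSetK₁₃ θ K₀ g₀ kr K, weightBK₁₃ θ hP K₀ g₀ os kr K t u) :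
    RelWeightBound 1 (classSetK₁₃ θ K₀ g₀ kr) (weightAK₁₃ θ hP K₀ g₀ os kr) (weightBK₁₃ θ hP K₀ g₀ os kr)
      (badClassK₁₃ θ K₀ g₀ kr (badKeyReadingOfBigComponent₁₃ N K₀ jcut (bigDialOfCard₁₃ K₀ (fun K j => n K j * (F.L ^ 4) ^ lv K j)) F θ hP g₀ os))
      (fun K => ∑ j ∈ Finset.Icc 1 (jcut K),
        Fintype.card (Site (F.P (K₀ + K)) (lv K j)) * ((3 : ℝ) ^ (F.P (K₀ + K)).d - 1) ^ (2 * (n K j - 1)) * δ K j ^ n K j) := by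
  have hδ₀ : 0 ≤ δ₀ := (hδ0 0 0).trans (hδ1 0 0)
  have hδ₀' : δ₀ ≤ 1 / 12800 := by nlinarith [hD]
  have hS : ∀ K, ∑ j ∈ Finset.Icc 1 (jcut K),
      Fintype.card (Site (F.P (K₀ + K)) (lv K j)) * ((3 : ℝ) ^ (F.P (K₀ + K)).d - 1) ^ (2 * (n K j - 1)) * δ K j ^ n K j ≤ δ₀ * (1 / 2) ^ (K + 1) :=
    levelSum_le_of_schedule K₀ jcut n lv hδ0 hδ1 hD hn
  have ha0 : ∀ K j, 0 ≤ Fintype.card (Site (F.P (K₀ + K)) (lv K j)) * ((3 : ℝ) ^ (F.P (K₀ + K)).d - 1) ^ (2 * (n K j - 1)) * δ K j ^ n K j := by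
    intro K j
    have h3 : (1 : ℝ) ≤ (3 : ℝ) ^ (F.P (K₀ + K)).d := one_le_pow₀ (by norm_num)
    exact mul_nonneg (mul_nonneg (Nat.cast_nonneg _) (pow_nonneg (by linarith) _)) (pow_nonneg (hδ0 K j) _)
  have hn1 : ∀ K j, 1 ≤ n K j := fun K j => le_trans (by omega) (hn K j)
  refine relWeightBound_card_of_blockEnergyLetters θ hP K₀ g₀ os kr jcut n lv hkr hδ0 hn1 hlv hEA hEB ?_ ?_
  · intro K
    calc ∑ j ∈ Finset.Icc 1 (jcut K), Fintype.card (Site (F.P (K₀ + K)) (lv K j)) * ((3 : ℝ) ^ (F.P (K₀ + K)).d - 1) ^ (2 * (n K j - 1)) * δ K j ^ n K j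
        ≤ δ₀ * (1 / 2) ^ (K + 1) := hS K
      _ ≤ 1 / 12800 * 1 := mul_le_mul hδ₀' (pow_le_one₀ (by norm_num) (by norm_num)) (pow_nonneg (by norm_num) _) (by norm_num)
      _ < 1 := by norm_num
  · refine Summable.of_nonneg_of_le (fun K => Finset.sum_nonneg fun j _ => ha0 K j) hS ?_
    exact (summable_geometric_of_lt_one (by norm_num) (by norm_num : (1 / 2 : ℝ) < 1)).mul_left δ₀ |>.comp_injective
      (add_left_injective 1) |>.congr (fun K => by simp [Function.comp, pow_succ])

/-- ★★★ **… WITH THE DISPLAYED GEOMETRIC WEIGHT `W K := δ₀ · 2^{−(K+1)}`** (the level-sum weight enlarged to its closed-form majorant; `δ₀ · 2^{−(K+1)} ≤ 1∕25600 < 1`,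
`Σ_K = δ₀`). [bookkeeping] -/
theorem relWeightBound_card_of_blockEnergyLetters_geometric
    (hkr : ∀ (K : ℕ) (x : Σ K, SiteSeqKey F (K₀ + K)), x ∈ classSet₁₃ θ K₀ g₀ K → (kr K x).1 = K)
    {δ : ℕ → ℕ → ℝ} {δ₀ : ℝ} (hδ0 : ∀ K j, 0 ≤ δ K j) (hδ1 : ∀ K j, δ K j ≤ δ₀) (hD : 2 * ((3 : ℝ) ^ 4 - 1) ^ 2 * δ₀ ≤ 1)
    (hn : ∀ K j, Nat.clog 2 (Fintype.card (Site (F.P (K₀ + K)) (lv K j))) + K + j + 3 ≤ n K j) (hlv : ∀ K j, lv K j ≤ F.m + (K₀ + K))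
    (hEA : ∀ (K : ℕ) (t : ℝ), |t| ≤ 1 → ∀ j ∈ Finset.Icc 1 (jcut K), ∀ p ∈ animalCoverFamily (SiteTouch (P := F.P (K₀ + K)) (j := lv K j)) (n K j),
      ∑ u ∈ badClassK₁₃ θ K₀ g₀ kr (fun _ u => ∀ y : SiteSeqKey F (K₀ + K), u = ⟨K, y⟩ →
          (↑p.2 : Set (Site (F.P (K₀ + K)) (lv K j))) ⊆ iterBlockOf (lv K j) '' (y.2 j)ᶜ) K t,
          weightAK₁₃ θ hP K₀ g₀ os kr K t u ≤ δ K j ^ n K j * ∑ u ∈ classSetK₁₃ θ K₀ g₀ kr K, weightAK₁₃ θ hP K₀ g₀ os kr K t u)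
    (hEB : ∀ (K : ℕ) (t : ℝ), |t| ≤ 1 → ∀ j ∈ Finset.Icc 1 (jcut K), ∀ p ∈ animalCoverFamily (SiteTouch (P := F.P (K₀ + K)) (j := lv K j)) (n K j),
      ∑ u ∈ badClassK₁₃ θ K₀ g₀ kr (fun _ u => ∀ y : SiteSeqKey F (K₀ + K), u = ⟨K, y⟩ →
          (↑p.2 : Set (Site (F.P (K₀ + K)) (lv K j))) ⊆ iterBlockOf (lv K j) '' (y.2 j)ᶜ) K t,
          weightBK₁₃ θ hP K₀ g₀ os kr K t u ≤ δ K j ^ n K j * ∑ u ∈ classSetK₁₃ θ K₀ g₀ kr K, weightBK₁₃ θ hP K₀ g₀ os kr K t u) :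
    RelWeightBound 1 (classSetK₁₃ θ K₀ g₀ kr) (weightAK₁₃ θ hP K₀ g₀ os kr) (weightBK₁₃ θ hP K₀ g₀ os kr)
      (badClassK₁₃ θ K₀ g₀ kr (badKeyReadingOfBigComponent₁₃ N K₀ jcut (bigDialOfCard₁₃ K₀ (fun K j => n K j * (F.L ^ 4) ^ lv K j)) F θ hP g₀ os))
      (fun K => δ₀ * (1 / 2) ^ (K + 1)) := by
  have hW := relWeightBound_card_of_blockEnergyLetters_of_schedule θ hP K₀ g₀ os kr jcut n lv hkr hδ0 hδ1 hD hn hlv hEA hEB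
  have hδ₀ : 0 ≤ δ₀ := (hδ0 0 0).trans (hδ1 0 0)
  have hδ₀' : δ₀ ≤ 1 / 12800 := by nlinarith [hD]
  have hS : ∀ K, ∑ j ∈ Finset.Icc 1 (jcut K),
      Fintype.card (Site (F.P (K₀ + K)) (lv K j)) * ((3 : ℝ) ^ (F.P (K₀ + K)).d - 1) ^ (2 * (n K j - 1)) * δ K j ^ n K j ≤ δ₀ * (1 / 2) ^ (K + 1) :=
    levelSum_le_of_schedule K₀ jcut n lv hδ0 hδ1 hD hn
  exact
  { bad_subset := hW.bad_subset
    nonneg := fun K => mul_nonneg hδ₀ (pow_nonneg (by norm_num) _)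
    lt_one := fun K => by
      calc δ₀ * (1 / 2 : ℝ) ^ (K + 1) ≤ 1 / 12800 * 1 :=
            mul_le_mul hδ₀' (pow_le_one₀ (by norm_num) (by norm_num)) (pow_nonneg (by norm_num) _) (by norm_num)
        _ < 1 := by norm_num
    summable := (summable_geometric_of_lt_one (by norm_num) (by norm_num : (1 / 2 : ℝ) < 1)).mul_left δ₀ |>.comp_injective
      (add_left_injective 1) |>.congr (fun K => by simp [Function.comp, pow_succ])
    bad_left := fun K t ht => (hW.bad_left K t ht).trans (mul_le_mul_of_nonneg_right (hS K)
      (Finset.sum_nonneg fun u _ => weightAK₁₃_nonneg θ hP K₀ g₀ os kr (fun x _ => weightA₁₃_nonneg F θ hP K₀ g₀ os K t x) u))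
    bad_right := fun K t ht => (hW.bad_right K t ht).trans (mul_le_mul_of_nonneg_right (hS K)
      (Finset.sum_nonneg fun u _ => weightBK₁₃_nonneg θ hP K₀ g₀ os kr (fun x _ => weightB₁₃_nonneg F θ hP K₀ g₀ os K t x) u)) }

end Schedule

end YMDAG.UVSplit

end
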